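import Mathlib
import Summits.Ventures.PercRepro2.MixChordOInactive
import Summits.Ventures.PercRepro2.MixChordLaw
import Summits.Ventures.PercRepro2.BHKOutside
import Summits.Ventures.PercRepro2.OrderPreservation

/-!
# The `D`-chord along a root edge to `o` when `a₃` is inactive — the strongest one-edge law of the
`o`-class, in the kernel (blind cell PercRepro2, night-1 g20; proofs/NIGHT1-G20.md §3)

Along `f = {o, a₁}` with `a₃` inactive (`PD = Q`, `Gc = 2 Z·S`, `A3Inactive.Gc_eq_of_a3Inactive`),
the `D`-chord `(1 − q)·Gc(p[f ↦ 0])·D(p) ≤ Gc(p)·D(p[f ↦ 0])` (`NMixChord normD`; with `D = Z` it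
reads `S(q) ≥ (1 − q)·S⁰`, STRONGER than g19's half-chord `Z⁰ S(q) ≥ (1 − q) Z(q) S⁰` by the factor
`Z⁰/Z(q) ≥ 1`) is the q-FREE closed-world inequality

`P⁰(Q, oH)·P⁰(Q, oN, o ↔ b) + P⁰(Q, oN)·P⁰(Q, oH, bH) ≥ P⁰(Q, oH)·P⁰(Q, bH, oN)`,

i.e. `P(bH | Q, oH) ≥ P(bH | Q, o ∉ U) − P(o ↔ b | Q, o ∉ U)`: the EXACT identity
`Z⁰·(S(q) − (1 − q)·S⁰) = q(1 − q)·Z⁰·(H⁰·W + HB⁰·(Z⁰ − O⁰) − H⁰·(B⁰ − BO⁰))` (`o_key_D`, with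
`W = L¹ − (L⁰ − LH⁰) = P⁰(Q, o ∉ U, o ↔ b) ≥ 0` the new mass of `{b ∈ C₁}` created by opening `f`)
and the SAME-CLUSTER BHK inequality with the root `a₁` avoiding the SET `{a₂, o}`
(mine-2's `bhk_two_outside_avoid`, BHK06 Thm 1.3 for `s ↮ X`): conditionally on
`a₁ ↮ a₂, a₁ ↮ o`, the events `{o ∈ C₂}` and `{b ∈ C₂}` are positively correlated —
`H⁰·(B⁰ − BO⁰) ≤ HB⁰·(Z⁰ − O⁰)` (**`bhk_oH_bH_avoid`**).  **`dChord_o_edge_of_a3Inactive`**; the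
`b`-edge `{b, a₁}` by the `o ↔ b` symmetry of the inactive `Gc` (**`dChord_b_edge_of_a3Inactive`**).
Exploration-martingale reading: the one-step increment `q(1−q)·H⁰·W` is signed pointwise and the
martingale part is one conditional BHK.

Own code; standard axioms.
-/

namespace Summit.Ventures.PercRepro2

open UnionCluster CovForm

namespace Mix

section OInactiveD

variable {V : Type*} {E : Type*} [Fintype E] [DecidableEq E] [Fintype V] [DecidableEq V]
  {R : Type*} [Field R] [LinearOrder R] [IsStrictOrderedRing R]

variable (p : E → R) (ends : E → Sym2 V) {o a₁ a₂ a₃ : V} (b : V) {f : E}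

omit [Fintype E] [DecidableEq E] [Fintype V] [LinearOrder R] [IsStrictOrderedRing R] in
/-- `{a₂ ↔ o} ∩ {a₁ ↮ a₂, a₁ ↮ o} = Q ∩ {a₂ ↔ o}`. -/
lemma conn2o_inter_avoid (o a₁ a₂ : V) :
    connEvent ends a₂ o ∩ avoidAll ends a₁ {a₂, o} = avoidAll ends a₂ {a₁} ∩ connEvent ends a₂ o := by
  ext ω
  simp only [Set.mem_inter_iff, mem_connEvent, mem_avoidAll, Finset.mem_insert,
    Finset.mem_singleton, forall_eq_or_imp, forall_eq]
  constructor
  · rintro ⟨h2o, h12, _⟩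
    exact ⟨fun h => h12 (conn_symm h), h2o⟩
  · rintro ⟨h21, h2o⟩
    exact ⟨h2o, fun h => h21 (conn_symm h), fun h => h21 (conn_trans h2o (conn_symm h))⟩

omit [Fintype E] [DecidableEq E] [Fintype V] [LinearOrder R] [IsStrictOrderedRing R] in
/-- `{a₂ ↔ o} ∩ {a₂ ↔ b} ∩ {a₁ ↮ a₂, a₁ ↮ o} = Q ∩ ({a₂ ↔ o} ∩ {a₂ ↔ b})`. -/
lemma conn2o_conn2b_inter_avoid (o a₁ a₂ b : V) :
    connEvent ends a₂ o ∩ connEvent ends a₂ b ∩ avoidAll ends a₁ {a₂, o} =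
      avoidAll ends a₂ {a₁} ∩ (connEvent ends a₂ o ∩ connEvent ends a₂ b) := by
  ext ω
  simp only [Set.mem_inter_iff, mem_connEvent, mem_avoidAll, Finset.mem_insert,
    Finset.mem_singleton, forall_eq_or_imp, forall_eq]
  constructor
  · rintro ⟨⟨h2o, h2b⟩, h12, _⟩
    exact ⟨fun h => h12 (conn_symm h), h2o, h2b⟩
  · rintro ⟨h21, h2o, h2b⟩
    exact ⟨⟨h2o, h2b⟩, fun h => h21 (conn_symm h), fun h => h21 (conn_trans h2o (conn_symm h))⟩

omit [Fintype E] [DecidableEq E] [Fintype V] [LinearOrder R] [IsStrictOrderedRing R] in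
/-- `{a₂ ↔ b} ∩ {a₁ ↮ a₂, a₁ ↮ o} = (Q ∩ {a₂ ↔ b}) ∩ {a₁ ↔ o}ᶜ`. -/
lemma conn2b_inter_avoid (o a₁ a₂ b : V) :
    connEvent ends a₂ b ∩ avoidAll ends a₁ {a₂, o} =
      (avoidAll ends a₂ {a₁} ∩ connEvent ends a₂ b) ∩ (connEvent ends a₁ o)ᶜ := by
  ext ω
  simp only [Set.mem_inter_iff, mem_connEvent, mem_avoidAll, Finset.mem_insert,
    Finset.mem_singleton, forall_eq_or_imp, forall_eq, Set.mem_compl_iff]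
  constructor
  · rintro ⟨h2b, h12, h1o⟩
    exact ⟨⟨fun h => h12 (conn_symm h), h2b⟩, h1o⟩
  · rintro ⟨⟨h21, h2b⟩, h1o⟩
    exact ⟨h2b, fun h => h21 (conn_symm h), h1o⟩

omit [Fintype E] [DecidableEq E] [Fintype V] [LinearOrder R] [IsStrictOrderedRing R] in
/-- `{a₁ ↮ a₂, a₁ ↮ o} = Q ∩ {a₁ ↔ o}ᶜ`. -/
lemma avoid_pair_eq (o a₁ a₂ : V) :
    avoidAll ends a₁ {a₂, o} = avoidAll ends a₂ {a₁} ∩ (connEvent ends a₁ o)ᶜ := by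
  ext ω
  simp only [Set.mem_inter_iff, mem_connEvent, mem_avoidAll, Finset.mem_insert,
    Finset.mem_singleton, forall_eq_or_imp, forall_eq, Set.mem_compl_iff]
  constructor
  · rintro ⟨h12, h1o⟩
    exact ⟨fun h => h12 (conn_symm h), h1o⟩
  · rintro ⟨h21, h1o⟩
    exact ⟨fun h => h21 (conn_symm h), h1o⟩

omit [Fintype E] [DecidableEq E] [Fintype V] [DecidableEq V] [LinearOrder R] [IsStrictOrderedRing R] in
/-- `Q ∩ {a₂ ↔ b} ∩ {a₁ ↔ o} = Q ∩ ({a₁ ↔ o} ∩ {a₂ ↔ b})`. -/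
lemma Q_conn2b_conn1o (o a₁ a₂ b : V) :
    avoidAll ends a₂ {a₁} ∩ connEvent ends a₂ b ∩ connEvent ends a₁ o =
      avoidAll ends a₂ {a₁} ∩ (connEvent ends a₁ o ∩ connEvent ends a₂ b) := by
  ext ω
  simp only [Set.mem_inter_iff]
  tauto

/-- **Same-cluster BHK for `{o ∈ C₂}`, `{b ∈ C₂}` with the root `a₁` avoiding `{a₂, o}`**:
`P(Q, oH)·(P(Q, bH) − P(Q, oL, bH)) ≤ P(Q, oH, bH)·(P(Q) − P(Q, oL))` — conditionally on
`a₁ ↮ a₂, a₁ ↮ o` the two events are positively correlated (mine-2's `bhk_two_outside_avoid`). -/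
lemma bhk_oH_bH_avoid (hp : IsProbVec p) (o a₁ a₂ : V) :
    prob p (avoidAll ends a₂ {a₁} ∩ connEvent ends a₂ o) *
        (prob p (avoidAll ends a₂ {a₁} ∩ connEvent ends a₂ b) -
          prob p (avoidAll ends a₂ {a₁} ∩ (connEvent ends a₁ o ∩ connEvent ends a₂ b))) ≤
      prob p (avoidAll ends a₂ {a₁} ∩ (connEvent ends a₂ o ∩ connEvent ends a₂ b)) *
        (prob p (avoidAll ends a₂ {a₁}) - prob p (avoidAll ends a₂ {a₁} ∩ connEvent ends a₁ o)) := by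
  have h := bhk_two_outside_avoid p hp ends a₁ a₂ a₂ ({a₂, o} : Finset V)
    (𝓤 := {W : Set V | o ∈ W}) (𝓥 := {W : Set V | b ∈ W})
    (fun _ _ hle h => hle h) (fun _ _ hle h => hle h)
  have hins : insert a₂ ({a₂, o} : Finset V) = {a₂, o} :=
    Finset.insert_eq_of_mem (Finset.mem_insert_self a₂ {o})
  rw [hins, hins, ← connEvent_eq_clusterInEvent ends a₂ o, ← connEvent_eq_clusterInEvent ends a₂ b,
    conn2o_inter_avoid, conn2b_inter_avoid, conn2o_conn2b_inter_avoid, avoid_pair_eq] at h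
  have e1 := prob_inter_add_prob_inter_compl p (avoidAll ends a₂ {a₁} ∩ connEvent ends a₂ b)
    (connEvent ends a₁ o)
  have e2 := prob_inter_add_prob_inter_compl p (avoidAll ends a₂ {a₁}) (connEvent ends a₁ o)
  rw [Q_conn2b_conn1o] at e1
  have e1' : prob p (avoidAll ends a₂ {a₁} ∩ connEvent ends a₂ b ∩ (connEvent ends a₁ o)ᶜ) =
      prob p (avoidAll ends a₂ {a₁} ∩ connEvent ends a₂ b) -
        prob p (avoidAll ends a₂ {a₁} ∩ (connEvent ends a₁ o ∩ connEvent ends a₂ b)) := by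
    linarith
  have e2' : prob p (avoidAll ends a₂ {a₁} ∩ (connEvent ends a₁ o)ᶜ) =
      prob p (avoidAll ends a₂ {a₁}) - prob p (avoidAll ends a₂ {a₁} ∩ connEvent ends a₁ o) := by
    linarith
  rw [e1', e2'] at h
  exact h

omit [Fintype E] [DecidableEq E] [Fintype V] [DecidableEq V] [LinearOrder R] [IsStrictOrderedRing R] in
/-- The cleared identity of the `D`-chord along `{o, a₁}` with `a₃` inactive, in abstract
variables (`Z¹ = Z⁰ − H⁰`, `B¹ = B⁰ − HB⁰`, `L¹ = L⁰ − LH⁰ + W`, `H¹ = LH¹ = 0`, `O¹ = Z¹`,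
`BO¹ = B¹`):
`Z⁰·(S(q) − (1 − q)·S⁰) = q(1 − q)·Z⁰·(H⁰·W + HB⁰·(Z⁰ − O⁰) − H⁰·(B⁰ − BO⁰))`. -/
lemma o_key_D (q Z0 Z1 L0 L1 B0 B1 H0 LH0 O0 BO0 HB0 W : R) (hZ1 : Z1 = Z0 - H0)
    (hB1 : B1 = B0 - HB0) (hL1 : L1 = L0 - LH0 + W) :
    Z0 * ((((q * L1 + (1 - q) * L0) * (q * 0 + (1 - q) * H0) -
          (q * Z1 + (1 - q) * Z0) * (q * 0 + (1 - q) * LH0)) +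
        ((q * B1 + (1 - q) * B0) * (q * Z1 + (1 - q) * O0) -
          (q * Z1 + (1 - q) * Z0) * (q * B1 + (1 - q) * BO0))) -
      (1 - q) * ((L0 * H0 - Z0 * LH0) + (B0 * O0 - Z0 * BO0))) =
      q * (1 - q) * Z0 * (H0 * W + HB0 * (Z0 - O0) - H0 * (B0 - BO0)) := by
  subst hZ1 hB1 hL1
  ring

/-- **The `D`-chord along `f = {o, a₁}` when `a₃` is inactive** (`NMixChord normD`): the strongest
one-edge law of the `o`-class, in the kernel on this class. -/
theorem dChord_o_edge_of_a3Inactive (hp : IsProbVec p) (hf : ends f = s(o, a₁))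
    (hin : ∀ ω : Config E, ¬ Conn ends ω a₁ a₃ ∧ ¬ Conn ends ω a₂ a₃) :
    NMixChord (normD ends a₁ a₂ a₃) p ends o a₁ a₂ a₃ b f := by
  have hp0 : IsProbVec (Function.update p f 0) := hp.update f le_rfl zero_le_one
  have hq0 := hp.nonneg f
  have hq1 := hp.le_one f
  have hc1 := conn_a1_o_of_update_one p ends hf
  have hG1 : Gc (Function.update p f 1) ends o a₁ a₂ a₃ b = 0 :=
    Gc_eq_zero_of_sure_conn_o _ ends o a₃ b hc1
  unfold NMixChord normD
  rw [hG1, mul_zero, sub_zero, A3Inactive.PDEvent_eq_Q hin,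
    A3Inactive.Gc_eq_of_a3Inactive p ends o a₁ a₂ a₃ b hin,
    A3Inactive.Gc_eq_of_a3Inactive (Function.update p f 0) ends o a₁ a₂ a₃ b hin]
  -- nonnegativity of the masses
  have hZ0 := prob_nonneg hp0 (avoidAll ends a₂ {a₁})
  have hZ := prob_nonneg hp (avoidAll ends a₂ {a₁})
  have hH0 := prob_nonneg hp0 (avoidAll ends a₂ {a₁} ∩ connEvent ends a₂ o)
  -- the coupling across `f` (g18's lemmas with the far end `o`)
  have hZ1 := RootEdge.prob_Q_update_one p ends (a₂ := a₂) hf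
  rw [TEvent_o] at hZ1
  have hB1 := RootEdge.prob_Q_conn2_update_one p ends (a₂ := a₂) hf b
  rw [TEvent_o_inter] at hB1
  have hL1 := RootEdge.prob_Q_conn1_update_one_ge p ends (a₂ := a₂) hp hf b
  rw [TEvent_o_inter] at hL1
  have hH1 : prob (Function.update p f 1) (avoidAll ends a₂ {a₁} ∩ connEvent ends a₂ o) = 0 :=
    prob_Q_conn₂_eq_zero _ ends hc1
  have hLH1 : prob (Function.update p f 1)
      (avoidAll ends a₂ {a₁} ∩ (connEvent ends a₂ o ∩ connEvent ends a₁ b)) = 0 :=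
    prob_inter_conn₂_eq_zero _ ends hc1 _ _ le_rfl
  have hO1 : prob (Function.update p f 1) (avoidAll ends a₂ {a₁} ∩ connEvent ends a₁ o) =
      prob (Function.update p f 1) (avoidAll ends a₂ {a₁}) :=
    prob_inter_conn_eq' _ ends hc1 _
  have hBO1 : prob (Function.update p f 1)
      (avoidAll ends a₂ {a₁} ∩ (connEvent ends a₁ o ∩ connEvent ends a₂ b)) =
      prob (Function.update p f 1) (avoidAll ends a₂ {a₁} ∩ connEvent ends a₂ b) :=
    prob_inter_conn_eq _ ends hc1 _ _
  -- the same-cluster BHK with the root avoiding `{a₂, o}`, at `p[f ↦ 0]`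
  have hbhk := bhk_oH_bH_avoid (Function.update p f 0) ends b hp0 o a₁ a₂
  -- the masses at `p` are mixtures
  have pQ := prob_eq_pin p (avoidAll ends a₂ {a₁}) f
  have pL := prob_eq_pin p (avoidAll ends a₂ {a₁} ∩ connEvent ends a₁ b) f
  have pH := prob_eq_pin p (avoidAll ends a₂ {a₁} ∩ connEvent ends a₂ o) f
  have pLH := prob_eq_pin p (avoidAll ends a₂ {a₁} ∩ (connEvent ends a₂ o ∩ connEvent ends a₁ b)) f
  have pB := prob_eq_pin p (avoidAll ends a₂ {a₁} ∩ connEvent ends a₂ b) f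
  have pO := prob_eq_pin p (avoidAll ends a₂ {a₁} ∩ connEvent ends a₁ o) f
  have pBO := prob_eq_pin p (avoidAll ends a₂ {a₁} ∩ (connEvent ends a₁ o ∩ connEvent ends a₂ b)) f
  rw [hH1, hLH1, hO1, hBO1] at *
  -- the identity with `W = L¹ − (L⁰ − LH⁰) ≥ 0`
  have hW : 0 ≤ prob (Function.update p f 1) (avoidAll ends a₂ {a₁} ∩ connEvent ends a₁ b) -
      (prob (Function.update p f 0) (avoidAll ends a₂ {a₁} ∩ connEvent ends a₁ b) -
        prob (Function.update p f 0)
          (avoidAll ends a₂ {a₁} ∩ (connEvent ends a₂ o ∩ connEvent ends a₁ b))) := by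
    linarith
  have hid := o_key_D (p f) (prob (Function.update p f 0) (avoidAll ends a₂ {a₁}))
    (prob (Function.update p f 1) (avoidAll ends a₂ {a₁}))
    (prob (Function.update p f 0) (avoidAll ends a₂ {a₁} ∩ connEvent ends a₁ b))
    (prob (Function.update p f 1) (avoidAll ends a₂ {a₁} ∩ connEvent ends a₁ b))
    (prob (Function.update p f 0) (avoidAll ends a₂ {a₁} ∩ connEvent ends a₂ b))
    (prob (Function.update p f 1) (avoidAll ends a₂ {a₁} ∩ connEvent ends a₂ b))
    (prob (Function.update p f 0) (avoidAll ends a₂ {a₁} ∩ connEvent ends a₂ o))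
    (prob (Function.update p f 0) (avoidAll ends a₂ {a₁} ∩ (connEvent ends a₂ o ∩ connEvent ends a₁ b)))
    (prob (Function.update p f 0) (avoidAll ends a₂ {a₁} ∩ connEvent ends a₁ o))
    (prob (Function.update p f 0) (avoidAll ends a₂ {a₁} ∩ (connEvent ends a₁ o ∩ connEvent ends a₂ b)))
    (prob (Function.update p f 0) (avoidAll ends a₂ {a₁} ∩ (connEvent ends a₂ o ∩ connEvent ends a₂ b)))
    (prob (Function.update p f 1) (avoidAll ends a₂ {a₁} ∩ connEvent ends a₁ b) -
      (prob (Function.update p f 0) (avoidAll ends a₂ {a₁} ∩ connEvent ends a₁ b) -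
        prob (Function.update p f 0)
          (avoidAll ends a₂ {a₁} ∩ (connEvent ends a₂ o ∩ connEvent ends a₁ b))))
    hZ1 hB1 (by ring)
  -- the bracket is nonnegative: `H⁰ W ≥ 0` and the BHK
  have hbr : 0 ≤ prob (Function.update p f 0) (avoidAll ends a₂ {a₁} ∩ connEvent ends a₂ o) *
      (prob (Function.update p f 1) (avoidAll ends a₂ {a₁} ∩ connEvent ends a₁ b) -
        (prob (Function.update p f 0) (avoidAll ends a₂ {a₁} ∩ connEvent ends a₁ b) -
          prob (Function.update p f 0)
            (avoidAll ends a₂ {a₁} ∩ (connEvent ends a₂ o ∩ connEvent ends a₁ b)))) +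
      prob (Function.update p f 0) (avoidAll ends a₂ {a₁} ∩ (connEvent ends a₂ o ∩ connEvent ends a₂ b)) *
        (prob (Function.update p f 0) (avoidAll ends a₂ {a₁}) -
          prob (Function.update p f 0) (avoidAll ends a₂ {a₁} ∩ connEvent ends a₁ o)) -
      prob (Function.update p f 0) (avoidAll ends a₂ {a₁} ∩ connEvent ends a₂ o) *
        (prob (Function.update p f 0) (avoidAll ends a₂ {a₁} ∩ connEvent ends a₂ b) -
          prob (Function.update p f 0)
            (avoidAll ends a₂ {a₁} ∩ (connEvent ends a₁ o ∩ connEvent ends a₂ b))) := by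
    linarith [mul_nonneg hH0 hW, hbhk]
  -- the masses at `p` are mixtures; the `p[f ↦ 1]` masses are their coupled values
  rw [pQ, pL, pH, pLH, pB, pO, pBO]
  have h1q : 0 ≤ 1 - p f := by linarith
  have hZq : 0 ≤ p f * prob (Function.update p f 1) (avoidAll ends a₂ {a₁}) +
      (1 - p f) * prob (Function.update p f 0) (avoidAll ends a₂ {a₁}) := by
    rw [← pQ]; exact hZ
  have key : 0 ≤ (p f * prob (Function.update p f 1) (avoidAll ends a₂ {a₁}) +
      (1 - p f) * prob (Function.update p f 0) (avoidAll ends a₂ {a₁})) *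
      (p f * (1 - p f) * prob (Function.update p f 0) (avoidAll ends a₂ {a₁}) *
        (prob (Function.update p f 0) (avoidAll ends a₂ {a₁} ∩ connEvent ends a₂ o) *
          (prob (Function.update p f 1) (avoidAll ends a₂ {a₁} ∩ connEvent ends a₁ b) -
            (prob (Function.update p f 0) (avoidAll ends a₂ {a₁} ∩ connEvent ends a₁ b) -
              prob (Function.update p f 0)
                (avoidAll ends a₂ {a₁} ∩ (connEvent ends a₂ o ∩ connEvent ends a₁ b)))) +
          prob (Function.update p f 0)
              (avoidAll ends a₂ {a₁} ∩ (connEvent ends a₂ o ∩ connEvent ends a₂ b)) *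
            (prob (Function.update p f 0) (avoidAll ends a₂ {a₁}) -
              prob (Function.update p f 0) (avoidAll ends a₂ {a₁} ∩ connEvent ends a₁ o)) -
          prob (Function.update p f 0) (avoidAll ends a₂ {a₁} ∩ connEvent ends a₂ o) *
            (prob (Function.update p f 0) (avoidAll ends a₂ {a₁} ∩ connEvent ends a₂ b) -
              prob (Function.update p f 0)
                (avoidAll ends a₂ {a₁} ∩ (connEvent ends a₁ o ∩ connEvent ends a₂ b))))) :=
    mul_nonneg hZq (mul_nonneg (mul_nonneg (mul_nonneg hq0 h1q) hZ0) hbr)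
  rw [← hid] at key
  linear_combination 2 * key

omit [Fintype V] [DecidableEq V] in
/-- With `a₃` inactive, `Gc` is symmetric under `o ↔ b` (`Gc = 2Z·S`, `S` symmetric). -/
lemma Gc_swap_ob_of_a3Inactive (o b : V)
    (hin : ∀ ω : Config E, ¬ Conn ends ω a₁ a₃ ∧ ¬ Conn ends ω a₂ a₃) :
    Gc p ends o a₁ a₂ a₃ b = Gc p ends b a₁ a₂ a₃ o := by
  rw [A3Inactive.Gc_eq_of_a3Inactive p ends o a₁ a₂ a₃ b hin,
    A3Inactive.Gc_eq_of_a3Inactive p ends b a₁ a₂ a₃ o hin,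
    Set.inter_comm (connEvent ends a₂ b) (connEvent ends a₁ o),
    Set.inter_comm (connEvent ends a₁ b) (connEvent ends a₂ o)]
  ring

/-- **The `D`-chord along `f = {b, a₁}` when `a₃` is inactive** (the `o ↔ b` symmetry of the
inactive `Gc`). -/
theorem dChord_b_edge_of_a3Inactive (hp : IsProbVec p) (hf : ends f = s(b, a₁))
    (hin : ∀ ω : Config E, ¬ Conn ends ω a₁ a₃ ∧ ¬ Conn ends ω a₂ a₃) :
    NMixChord (normD ends a₁ a₂ a₃) p ends o a₁ a₂ a₃ b f := by
  have h := dChord_o_edge_of_a3Inactive (o := b) p ends o hp hf hin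
  unfold NMixChord at h ⊢
  rwa [Gc_swap_ob_of_a3Inactive p ends o b hin, Gc_swap_ob_of_a3Inactive (Function.update p f 0) ends o b hin,
    Gc_swap_ob_of_a3Inactive (Function.update p f 1) ends o b hin]

end OInactiveD

end Mix

end Summit.Ventures.PercRepro2
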